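import Summits.Langlands.Langlands.Theses.PhantomRMYoshida
import Summits.Langlands.Langlands.Theorems.PhantomRMYoshidaStableYoshidaCongruenceDetCondIdle
import Summits.Langlands.Langlands.Theorems.PhantomRMYoshidaStableYoshidaCongruenceSplit
import HarnessLib

/-!
# Line `automorphic-galois-split` — REDUCTION skeleton for the crux
`Summit.Langlands.Langlands.Theses.PhantomRMYoshida.StableYoshidaCongruence` (stmt-Langlands-13640)

Crux-strategist line (unit `cstrat-stmt-Langlands-13640-s1`, 2026-08-17), registered as an ALTERNATIVE to the six
dead `by_cases`-sector lines (`Lines/*-dead.md`).  Card: `Lines/automorphic-galois-split.md`.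

## What this line is — and is not

It is NOT a seventh sector attack.  Every sector line died at the same place BY CONSTRUCTION (its off-sector
remainder is the crux's reducible-witness surplus, regime R4 of `Disproof.lean` §5), and eleven concurring lead
verdicts (VERDICT-c10 … c21) plus two strategist censuses say the only move left on the UNCHANGED parent is the
typed decomposition `crux ⇐ automorphic half ∧ Galois half`.  The gate lets a seat file that decomposition only on
its FINAL cycle (`split.final_cycle_only`; strategist attempts bounced 2026-08-17T01:14Z and 11:55Z).  This skeleton
therefore CARRIES the decomposition as a registered two-stub line, so that

* the two halves exist NOW as registered stub signatures (byte-identical to `children_min.json` of `SPLIT-s1.md`):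
  provers land sector / functorial supply theorems `--supports stmt-Langlands-13640` against
  `stub_irregularSymplecticLifting`, and the standing disprover gets an AUTOMORPHY-FREE target (a rigid pair refutes
  stub 2 in Lean with no `CuspidalAutomorphicRepData` term, unlike the parent: Disproof §2);
* the lead who holds this line files, ON ITS FINAL CYCLE, the harness-offered reduction with EXACTLY these two stubs
  as the subs (k = 2; glue = the crux workfile `StrategistSplitMin.lean`, decl
  `…StrategistSplitMin.stableYoshidaCongruence_of_subs` : stub 1 → stub 2 → crux — the same term as `StableYoshidaCongruence_of` below) — or any seat with
  split permission runs the one command in `SPLIT-s1.md`.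

## Registered stubs (2) — both genuine, neither the crux reworded

1. `stub_stableYoshidaCongruenceIrr` — THE AUTOMORPHIC HALF (= proposed child `StableYoshidaCongruenceIrr`): the crux
   with its witness hypothesis strengthened to an IRREDUCIBLE witness and its two provably idle hypotheses
   (`det σ' = det σ`, non-conjugacy: p156186 / p155497) deleted.  Strictly weaker than the crux (stronger hypothesis);
   exactly what the route's `closes` consumes (`langlands_of_subs₁`); target-strength modulo the KW gate + crux 2.
   Engine in kind: ABSOLUTE `R^{Sh}_𝔪 = 𝕋_𝔪` at the endoscopic `𝔪` in weight (2,2) (crux 2 read absolutely).  XL / open.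
2. `stub_irregularSymplecticLifting` — THE GALOIS HALF (= proposed child `IrregularSymplecticLifting`): for an
   eligible pair with SOME `Sh`-lift, an IRREDUCIBLE `Sh`-lift exists at some level.  No `ι`, `hcpt`, `π`, `AutGL2`.
   Strictly weaker conclusion than the crux; TRUE on the p = 3 / p = 5 motivic sectors and the functorial loci R1/D1
   (landed sector theorems re-key here), OPEN of expected dimension −1 generically, plausibly false for some pair.

`StableYoshidaCongruence_of` concludes the crux BY NAME from the two stubs by the LANDED glue
`Theorems.PhantomRMYoshida.stableYoshidaCongruence_of_minimalSubs` (p161961, lead c22; = `StrategistSplitMin.stableYoshidaCongruence_of_subs`).  Sorries: exactly 2, inside the two `stub_*`.  Honours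
`Disproof.lean`: the `_false_without_`-type content is §2's automorphic wall (any ¬crux needs a GL₂ cusp-form term) —
respected, since stub 2 moves the refutable content OUT of the wall; the landed negative lemma
`Theorems/StableYoshidaCongruence/Negative/StableYoshidaCongruenceFalseOfRigidPair.lean` (p151787, `RigidPair → ¬crux`)
refutes no instance of either stub (a rigid pair would refute stub 2 — that is the point — but none is constructible).
-/

set_option linter.dupNamespace false

namespace Summit.Langlands.Langlands.Cruxes.StableYoshidaCongruence.AutomorphicGaloisSplit

open Summit.Langlands.Langlands.Theses.PhantomRMYoshida
open Summit.Langlands.Langlands.Theorems.PhantomRMYoshida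
open Literature.NumberTheory.GaloisRepresentations Literature.NumberTheory.Automorphic
open Summit.Langlands.Langlands.Cruxes.StableYoshidaCongruence.LevelThreeWeierstrassSwitch
  (epsBar Sh AutGL2 AutGL4 DetCond NonConj CruxAt crux_iff)

/-! ## Registered stubs -/

/-- **Stub 1 (XL, open): the automorphic half** — verbatim `StableYoshidaCongruenceIrr`. -/
theorem stub_stableYoshidaCongruenceIrr : ∀ (p : ℕ) [Fact p.Prime], p ≠ 2 → ∀ (k : Type) [Field k] [CharP k p] [IsAlgClosed k] [TopologicalSpace k] [DiscreteTopology k] (red : Valued.integer (PadicAlgCl p) →+* k) (σ σ' : Literature.NumberTheory.GaloisRepresentations.FramedGaloisRep ℚ k 2), let εb : Field.absoluteGaloisGroup ℚ →* (ZMod p)ˣ := (modularCyclotomicCharacter (AlgebraicClosure ℚ) (HasEnoughRootsOfUnity.natCard_rootsOfUnity (AlgebraicClosure ℚ) p)).comp (MulSemiringAction.toRingAut (Field.absoluteGaloisGroup ℚ) (AlgebraicClosure ℚ)); let Sh := fun r : Literature.NumberTheory.GaloisRepresentations.FramedGaloisRep ℚ (PadicAlgCl p) 4 => (r.IsSymplecticWithMultiplierFun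 (fun g => algebraMap ℚ_[p] (PadicAlgCl p) ((((Literature.NumberTheory.GaloisRepresentations.GaloisRep.cyclotomicCharacter ℚ p g)⁻¹ : ℤ_[p]ˣ) : ℤ_[p]) : ℚ_[p])) ∧ (∀ v : IsDedekindDomain.HeightOneSpectrum (NumberField.RingOfIntegers ℚ), ((p : ℕ) : NumberField.RingOfIntegers ℚ) ∈ v.asIdeal → r.IsGreenbergOrdinaryOfShapeAt v ![0, 0, 1, 1] ∧ r.IsResiduallyDistinguishedAt v ![0, 0, 1, 1]) ∧ (∀ᶠ v : IsDedekindDomain.HeightOneSpectrum (NumberField.RingOfIntegers ℚ) in Filter.cofinite, r.IsUnramifiedAt v ∧ σ.IsUnramifiedAt v ∧ σ'.IsUnramifiedAt v ∧ ∃ (P : Polynomial (Valued.integer (PadicAlgCl p))) (P₁ P₂ : Polynomial k), r.HasFrobCharpolyAt v (P.map (Valued.integer (PadicAlgCl p)).subtype) ∧ σ.HasFrobCharpolyAt v P₁ ∧ σ'.HasFrobCharpolyAt v P₂ ∧ P.map red = P₁ * P₂)); let AutGL2 := fun s : Literature.NumberTheory.GaloisRepresentations.FramedGaloisRep ℚ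 k 2 => (∀ (hcpt₂ : Literature.NumberTheory.Automorphic.isCompact_glFiniteIntegralLevel 2 ℚ) (ι : PadicAlgCl p ≃+* ℂ), ∃ π₂ : Literature.NumberTheory.Automorphic.CuspidalAutomorphicRepData 2 ℚ hcpt₂, π₂.1.IsLAlgebraic ∧ ∀ᶠ v : IsDedekindDomain.HeightOneSpectrum (NumberField.RingOfIntegers ℚ) in Filter.cofinite, ∃ (a : Multiset ℂ) (P : Polynomial (Valued.integer (PadicAlgCl p))) (Pb : Polynomial k), π₂.1.HasSatakeParamAt v a ∧ P.map (Valued.integer (PadicAlgCl p)).subtype = Literature.NumberTheory.Automorphic.arithFrobPolyOfSatake ι v.residueCard 1 a ∧ s.IsUnramifiedAt v ∧ s.HasFrobCharpolyAt v Pb ∧ P.map red = Pb); AutGL2 σ → AutGL2 σ' → σ.toGaloisRep.IsIrreducible → σ'.toGaloisRep.IsIrreducible → (∀ g, Literature.NumberTheory.GaloisRepresentations.FramedRep.det σ g = (Units.map (ZMod.castHom (dvd_refl p) k).toMonoidHom (εb g))⁻¹) → (∃ ρ : Literature.NumberTheory.GaloisRepresentations.FramedGaloisRep ℚ (PadicAlgCl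 p) 4, ρ.toGaloisRep.IsIrreducible ∧ Sh ρ) → ∀ (hcpt : Literature.NumberTheory.Automorphic.isCompact_glFiniteIntegralLevel 4 ℚ) (ι : PadicAlgCl p ≃+* ℂ), ∃ ρ₀ : Literature.NumberTheory.GaloisRepresentations.FramedGaloisRep ℚ (PadicAlgCl p) 4, ρ₀.toGaloisRep.IsIrreducible ∧ Sh ρ₀ ∧ (∃ π : Literature.NumberTheory.Automorphic.CuspidalAutomorphicRepData 4 ℚ hcpt, π.1.IsLAlgebraic ∧ ∀ᶠ v : IsDedekindDomain.HeightOneSpectrum (NumberField.RingOfIntegers ℚ) in Filter.cofinite, ∃ a : Multiset ℂ, π.1.HasSatakeParamAt v a ∧ ρ₀.IsUnramifiedAt v ∧ ρ₀.HasFrobCharpolyAt v (Literature.NumberTheory.Automorphic.arithFrobPolyOfSatake ι v.residueCard 1 a)) := by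
  sorry

/-- **Stub 2 (XL, open generically; closed on sectors): the Galois half** — verbatim `IrregularSymplecticLifting`. -/
theorem stub_irregularSymplecticLifting : ∀ (p : ℕ) [Fact p.Prime], p ≠ 2 → ∀ (k : Type) [Field k] [CharP k p] [IsAlgClosed k] [TopologicalSpace k] [DiscreteTopology k] (red : Valued.integer (PadicAlgCl p) →+* k) (σ σ' : Literature.NumberTheory.GaloisRepresentations.FramedGaloisRep ℚ k 2), let εb : Field.absoluteGaloisGroup ℚ →* (ZMod p)ˣ := (modularCyclotomicCharacter (AlgebraicClosure ℚ) (HasEnoughRootsOfUnity.natCard_rootsOfUnity (AlgebraicClosure ℚ) p)).comp (MulSemiringAction.toRingAut (Field.absoluteGaloisGroup ℚ) (AlgebraicClosure ℚ)); let Sh := fun r : Literature.NumberTheory.GaloisRepresentations.FramedGaloisRep ℚ (PadicAlgCl p) 4 => (r.IsSymplecticWithMultiplierFun (fun g => algebraMap ℚ_[p] (PadicAlgCl p) ((((Literature.NumberTheory.GaloisRepresentations.GaloisRep.cyclotomicCharacter ℚ p g)⁻¹ : ℤ_[p]ˣ) : ℤ_[p]) : ℚ_[p])) ∧ (∀ v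 : IsDedekindDomain.HeightOneSpectrum (NumberField.RingOfIntegers ℚ), ((p : ℕ) : NumberField.RingOfIntegers ℚ) ∈ v.asIdeal → r.IsGreenbergOrdinaryOfShapeAt v ![0, 0, 1, 1] ∧ r.IsResiduallyDistinguishedAt v ![0, 0, 1, 1]) ∧ (∀ᶠ v : IsDedekindDomain.HeightOneSpectrum (NumberField.RingOfIntegers ℚ) in Filter.cofinite, r.IsUnramifiedAt v ∧ σ.IsUnramifiedAt v ∧ σ'.IsUnramifiedAt v ∧ ∃ (P : Polynomial (Valued.integer (PadicAlgCl p))) (P₁ P₂ : Polynomial k), r.HasFrobCharpolyAt v (P.map (Valued.integer (PadicAlgCl p)).subtype) ∧ σ.HasFrobCharpolyAt v P₁ ∧ σ'.HasFrobCharpolyAt v P₂ ∧ P.map red = P₁ * P₂)); σ.toGaloisRep.IsIrreducible → σ'.toGaloisRep.IsIrreducible → (∀ g, Literature.NumberTheory.GaloisRepresentations.FramedRep.det σ g = (Units.map (ZMod.castHom (dvd_refl p) k).toMonoidHom (εb g))⁻¹) → (∃ ρ : Literature.NumberTheory.GaloisRepresentations.FramedGaloisRep ℚ (PadicAlgCl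 p) 4, Sh ρ) → ∃ ρ₁ : Literature.NumberTheory.GaloisRepresentations.FramedGaloisRep ℚ (PadicAlgCl p) 4, ρ₁.toGaloisRep.IsIrreducible ∧ Sh ρ₁ := by
  sorry

/-! ## Glue (sorry-free) -/

/-- **`StableYoshidaCongruence` from the line `automorphic-galois-split`** (THE SKELETON THEOREM — first theorem in the
file concluding the crux).  Pure logic from the two registered stubs: at fixed data stub 2 turns the crux's (possibly
reducible) witness into an irreducible one, which stub 1 accepts; the crux's idle hypotheses and (for stub 2) its
`AutGL2` hypotheses are simply not passed on.  The type is literally the route decl; the only sorries in its cone are the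
two stubs. -/
theorem StableYoshidaCongruence_of : StableYoshidaCongruence :=
  -- the glue is LANDED (p161961, `Theorems/PhantomRMYoshidaStableYoshidaCongruenceSplit.lean`,
  -- registered glue stub `stableYoshidaCongruence_of_minimalSubs`): child 1 → child 2 → crux
  stableYoshidaCongruence_of_minimalSubs stub_stableYoshidaCongruenceIrr stub_irregularSymplecticLifting

/-! ## Sanity (sorry-free): the halves are NOT the crux reworded, and the split is exact modulo the KW gate -/

/-- The crux implies stub 1 unconditionally (idle hypotheses rebuilt from the witness: p156186, p155497). -/
theorem stub₁_of_crux (h : StableYoshidaCongruence) :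
    (∀ (p : ℕ) [Fact p.Prime], p ≠ 2 → ∀ (k : Type) [Field k] [CharP k p] [IsAlgClosed k] [TopologicalSpace k] [DiscreteTopology k] (red : Valued.integer (PadicAlgCl p) →+* k) (σ σ' : Literature.NumberTheory.GaloisRepresentations.FramedGaloisRep ℚ k 2), let εb : Field.absoluteGaloisGroup ℚ →* (ZMod p)ˣ := (modularCyclotomicCharacter (AlgebraicClosure ℚ) (HasEnoughRootsOfUnity.natCard_rootsOfUnity (AlgebraicClosure ℚ) p)).comp (MulSemiringAction.toRingAut (Field.absoluteGaloisGroup ℚ) (AlgebraicClosure ℚ)); let Sh := fun r : Literature.NumberTheory.GaloisRepresentations.FramedGaloisRep ℚ (PadicAlgCl p) 4 => (r.IsSymplecticWithMultiplierFun (fun g => algebraMap ℚ_[p] (PadicAlgCl p) ((((Literature.NumberTheory.GaloisRepresentations.GaloisRep.cyclotomicCharacter ℚ p g)⁻¹ : ℤ_[p]ˣ) : ℤ_[p]) : ℚ_[p])) ∧ (∀ v : IsDedekindDomain.HeightOneSpectrum (NumberField.RingOfIntegers ℚ), ((p : ℕ) : NumberField.RingOfIntegers ℚ) ∈ v.asIdeal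 → r.IsGreenbergOrdinaryOfShapeAt v ![0, 0, 1, 1] ∧ r.IsResiduallyDistinguishedAt v ![0, 0, 1, 1]) ∧ (∀ᶠ v : IsDedekindDomain.HeightOneSpectrum (NumberField.RingOfIntegers ℚ) in Filter.cofinite, r.IsUnramifiedAt v ∧ σ.IsUnramifiedAt v ∧ σ'.IsUnramifiedAt v ∧ ∃ (P : Polynomial (Valued.integer (PadicAlgCl p))) (P₁ P₂ : Polynomial k), r.HasFrobCharpolyAt v (P.map (Valued.integer (PadicAlgCl p)).subtype) ∧ σ.HasFrobCharpolyAt v P₁ ∧ σ'.HasFrobCharpolyAt v P₂ ∧ P.map red = P₁ * P₂)); let AutGL2 := fun s : Literature.NumberTheory.GaloisRepresentations.FramedGaloisRep ℚ k 2 => (∀ (hcpt₂ : Literature.NumberTheory.Automorphic.isCompact_glFiniteIntegralLevel 2 ℚ) (ι : PadicAlgCl p ≃+* ℂ), ∃ π₂ : Literature.NumberTheory.Automorphic.CuspidalAutomorphicRepData 2 ℚ hcpt₂, π₂.1.IsLAlgebraic ∧ ∀ᶠ v : IsDedekindDomain.HeightOneSpectrum (NumberField.RingOfIntegers ℚ)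 in Filter.cofinite, ∃ (a : Multiset ℂ) (P : Polynomial (Valued.integer (PadicAlgCl p))) (Pb : Polynomial k), π₂.1.HasSatakeParamAt v a ∧ P.map (Valued.integer (PadicAlgCl p)).subtype = Literature.NumberTheory.Automorphic.arithFrobPolyOfSatake ι v.residueCard 1 a ∧ s.IsUnramifiedAt v ∧ s.HasFrobCharpolyAt v Pb ∧ P.map red = Pb); AutGL2 σ → AutGL2 σ' → σ.toGaloisRep.IsIrreducible → σ'.toGaloisRep.IsIrreducible → (∀ g, Literature.NumberTheory.GaloisRepresentations.FramedRep.det σ g = (Units.map (ZMod.castHom (dvd_refl p) k).toMonoidHom (εb g))⁻¹) → (∃ ρ : Literature.NumberTheory.GaloisRepresentations.FramedGaloisRep ℚ (PadicAlgCl p) 4, ρ.toGaloisRep.IsIrreducible ∧ Sh ρ) → ∀ (hcpt : Literature.NumberTheory.Automorphic.isCompact_glFiniteIntegralLevel 4 ℚ) (ι : PadicAlgCl p ≃+* ℂ), ∃ ρ₀ : Literature.NumberTheory.GaloisRepresentations.FramedGaloisRep ℚ (PadicAlgCl p) 4, ρ₀.toGaloisRep.IsIrreducible ∧ Sh ρ₀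 ∧ (∃ π : Literature.NumberTheory.Automorphic.CuspidalAutomorphicRepData 4 ℚ hcpt, π.1.IsLAlgebraic ∧ ∀ᶠ v : IsDedekindDomain.HeightOneSpectrum (NumberField.RingOfIntegers ℚ) in Filter.cofinite, ∃ a : Multiset ℂ, π.1.HasSatakeParamAt v a ∧ ρ₀.IsUnramifiedAt v ∧ ρ₀.HasFrobCharpolyAt v (Literature.NumberTheory.Automorphic.arithFrobPolyOfSatake ι v.residueCard 1 a))) := by
  intro p _ hp k _ _ _ _ _ red σ σ' εb Sh AutGL2 h₁ h₂ h₃ h₄ hdet hw hcpt ι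
  obtain ⟨ρ, hirr, hSh⟩ := hw
  have hdc : DetCond p σ σ' := detCond_of_det_of_sh hdet hSh
  have hnc : NonConj σ σ' := nonConj_of_detCond_of_sh hp hdc hSh
  exact h p hp k red σ σ' h₁ h₂ h₃ h₄ hdc hnc ⟨ρ, hSh⟩ hcpt ι

/-- The KW gate item and the crux imply stub 2 (oddness is free; instantiate `hcpt`, `ι`; forget automorphy). -/
theorem stub₂_of_KW_of_crux (hKW : SerreKWAutomorphicGL2) (h : StableYoshidaCongruence) :
    (∀ (p : ℕ) [Fact p.Prime], p ≠ 2 → ∀ (k : Type) [Field k] [CharP k p] [IsAlgClosed k] [TopologicalSpace k] [DiscreteTopology k] (red : Valued.integer (PadicAlgCl p) →+* k) (σ σ' : Literature.NumberTheory.GaloisRepresentations.FramedGaloisRep ℚ k 2), let εb : Field.absoluteGaloisGroup ℚ →* (ZMod p)ˣ := (modularCyclotomicCharacter (AlgebraicClosure ℚ) (HasEnoughRootsOfUnity.natCard_rootsOfUnity (AlgebraicClosure ℚ) p)).comp (MulSemiringAction.toRingAut (Field.absoluteGaloisGroup ℚ) (AlgebraicClosure ℚ)); let Sh := fun r : Literature.NumberTheory.GaloisRepresentations.FramedGaloisRep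 ℚ (PadicAlgCl p) 4 => (r.IsSymplecticWithMultiplierFun (fun g => algebraMap ℚ_[p] (PadicAlgCl p) ((((Literature.NumberTheory.GaloisRepresentations.GaloisRep.cyclotomicCharacter ℚ p g)⁻¹ : ℤ_[p]ˣ) : ℤ_[p]) : ℚ_[p])) ∧ (∀ v : IsDedekindDomain.HeightOneSpectrum (NumberField.RingOfIntegers ℚ), ((p : ℕ) : NumberField.RingOfIntegers ℚ) ∈ v.asIdeal → r.IsGreenbergOrdinaryOfShapeAt v ![0, 0, 1, 1] ∧ r.IsResiduallyDistinguishedAt v ![0, 0, 1, 1]) ∧ (∀ᶠ v : IsDedekindDomain.HeightOneSpectrum (NumberField.RingOfIntegers ℚ) in Filter.cofinite, r.IsUnramifiedAt v ∧ σ.IsUnramifiedAt v ∧ σ'.IsUnramifiedAt v ∧ ∃ (P : Polynomial (Valued.integer (PadicAlgCl p))) (P₁ P₂ : Polynomial k), r.HasFrobCharpolyAt v (P.map (Valued.integer (PadicAlgCl p)).subtype) ∧ σ.HasFrobCharpolyAt v P₁ ∧ σ'.HasFrobCharpolyAt v P₂ ∧ P.map red = P₁ * P₂)); σ.toGaloisRep.IsIrreducible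 → σ'.toGaloisRep.IsIrreducible → (∀ g, Literature.NumberTheory.GaloisRepresentations.FramedRep.det σ g = (Units.map (ZMod.castHom (dvd_refl p) k).toMonoidHom (εb g))⁻¹) → (∃ ρ : Literature.NumberTheory.GaloisRepresentations.FramedGaloisRep ℚ (PadicAlgCl p) 4, Sh ρ) → ∃ ρ₁ : Literature.NumberTheory.GaloisRepresentations.FramedGaloisRep ℚ (PadicAlgCl p) 4, ρ₁.toGaloisRep.IsIrreducible ∧ Sh ρ₁) := by
  intro p _ hp k _ _ _ _ _ red σ σ' εb Sh h₃ h₄ hdet hw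
  obtain ⟨ρ, hSh⟩ := hw
  have hdc : DetCond p σ σ' := detCond_of_det_of_sh hdet hSh
  have hnc : NonConj σ σ' := nonConj_of_detCond_of_sh hp hdc hSh
  have hodd := isOdd_of_det_eq_inv_epsBar hdc
  obtain ⟨ι⟩ :=
    Literature.NumberTheory.GaloisRepresentations.NumberField.nonempty_algebraicClosure_padic_ringEquiv_complex p
  obtain ⟨ρ₀, hirr, hSh₀, -⟩ :=
    h p hp k red σ σ' (hKW p k red σ hodd.1 h₃) (hKW p k red σ' hodd.2 h₄) h₃ h₄ hdc hnc ⟨ρ, hSh⟩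
      (isCompact_glFiniteIntegralLevel_holds 4 ℚ) ι
  exact ⟨ρ₀, hirr, hSh₀⟩

/-- **Re-glue term**: the route closes through STUB 1 ALONE (stub 2 is surplus for `closes`). -/
theorem langlands_of_stub₁ (hKW : SerreKWAutomorphicGL2)
    (hA : (∀ (p : ℕ) [Fact p.Prime], p ≠ 2 → ∀ (k : Type) [Field k] [CharP k p] [IsAlgClosed k] [TopologicalSpace k] [DiscreteTopology k] (red : Valued.integer (PadicAlgCl p) →+* k) (σ σ' : Literature.NumberTheory.GaloisRepresentations.FramedGaloisRep ℚ k 2), let εb : Field.absoluteGaloisGroup ℚ →* (ZMod p)ˣ := (modularCyclotomicCharacter (AlgebraicClosure ℚ) (HasEnoughRootsOfUnity.natCard_rootsOfUnity (AlgebraicClosure ℚ) p)).comp (MulSemiringAction.toRingAut (Field.absoluteGaloisGroup ℚ) (AlgebraicClosure ℚ)); let Sh := fun r : Literature.NumberTheory.GaloisRepresentations.FramedGaloisRep ℚ (PadicAlgCl p) 4 => (r.IsSymplecticWithMultiplierFun (fun g => algebraMap ℚ_[p] (PadicAlgCl p) ((((Literature.NumberTheory.GaloisRepresentations.GaloisRep.cyclotomicCharacter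 ℚ p g)⁻¹ : ℤ_[p]ˣ) : ℤ_[p]) : ℚ_[p])) ∧ (∀ v : IsDedekindDomain.HeightOneSpectrum (NumberField.RingOfIntegers ℚ), ((p : ℕ) : NumberField.RingOfIntegers ℚ) ∈ v.asIdeal → r.IsGreenbergOrdinaryOfShapeAt v ![0, 0, 1, 1] ∧ r.IsResiduallyDistinguishedAt v ![0, 0, 1, 1]) ∧ (∀ᶠ v : IsDedekindDomain.HeightOneSpectrum (NumberField.RingOfIntegers ℚ) in Filter.cofinite, r.IsUnramifiedAt v ∧ σ.IsUnramifiedAt v ∧ σ'.IsUnramifiedAt v ∧ ∃ (P : Polynomial (Valued.integer (PadicAlgCl p))) (P₁ P₂ : Polynomial k), r.HasFrobCharpolyAt v (P.map (Valued.integer (PadicAlgCl p)).subtype) ∧ σ.HasFrobCharpolyAt v P₁ ∧ σ'.HasFrobCharpolyAt v P₂ ∧ P.map red = P₁ * P₂)); let AutGL2 := fun s : Literature.NumberTheory.GaloisRepresentations.FramedGaloisRep ℚ k 2 => (∀ (hcpt₂ : Literature.NumberTheory.Automorphic.isCompact_glFiniteIntegralLevel 2 ℚ) (ι : PadicAlgCl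 p ≃+* ℂ), ∃ π₂ : Literature.NumberTheory.Automorphic.CuspidalAutomorphicRepData 2 ℚ hcpt₂, π₂.1.IsLAlgebraic ∧ ∀ᶠ v : IsDedekindDomain.HeightOneSpectrum (NumberField.RingOfIntegers ℚ) in Filter.cofinite, ∃ (a : Multiset ℂ) (P : Polynomial (Valued.integer (PadicAlgCl p))) (Pb : Polynomial k), π₂.1.HasSatakeParamAt v a ∧ P.map (Valued.integer (PadicAlgCl p)).subtype = Literature.NumberTheory.Automorphic.arithFrobPolyOfSatake ι v.residueCard 1 a ∧ s.IsUnramifiedAt v ∧ s.HasFrobCharpolyAt v Pb ∧ P.map red = Pb); AutGL2 σ → AutGL2 σ' → σ.toGaloisRep.IsIrreducible → σ'.toGaloisRep.IsIrreducible → (∀ g, Literature.NumberTheory.GaloisRepresentations.FramedRep.det σ g = (Units.map (ZMod.castHom (dvd_refl p) k).toMonoidHom (εb g))⁻¹) → (∃ ρ : Literature.NumberTheory.GaloisRepresentations.FramedGaloisRep ℚ (PadicAlgCl p) 4, ρ.toGaloisRep.IsIrreducible ∧ Sh ρ) → ∀ (hcpt : Literature.NumberTheory.Automorphic.isCompact_glFiniteIntegralLevel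 4 ℚ) (ι : PadicAlgCl p ≃+* ℂ), ∃ ρ₀ : Literature.NumberTheory.GaloisRepresentations.FramedGaloisRep ℚ (PadicAlgCl p) 4, ρ₀.toGaloisRep.IsIrreducible ∧ Sh ρ₀ ∧ (∃ π : Literature.NumberTheory.Automorphic.CuspidalAutomorphicRepData 4 ℚ hcpt, π.1.IsLAlgebraic ∧ ∀ᶠ v : IsDedekindDomain.HeightOneSpectrum (NumberField.RingOfIntegers ℚ) in Filter.cofinite, ∃ a : Multiset ℂ, π.1.HasSatakeParamAt v a ∧ ρ₀.IsUnramifiedAt v ∧ ρ₀.HasFrobCharpolyAt v (Literature.NumberTheory.Automorphic.arithFrobPolyOfSatake ι v.residueCard 1 a))))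
    (hL : ResiduallyYoshidaLifting) (hJ : PhantomRMJunction) : _root_.Langlands :=
  langlands_of_stableYoshidaCongruenceIrr hKW
    (fun p _ hp k _ _ _ _ _ red σ σ' h₁ h₂ h₃ h₄ h₅ _h₆ hw hcpt ι =>
      hA p hp k red σ σ' h₁ h₂ h₃ h₄ (fun g => (h₅ g).1) hw hcpt ι)
    hL hJ

end Summit.Langlands.Langlands.Cruxes.StableYoshidaCongruence.AutomorphicGaloisSplit
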